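import Mathlib.Analysis.Fourier.FourierTransformDeriv
import Literature.Analysis.Calculus.AnalyticFlatness
import HarnessLib

/-!
# Directional decay of the Fourier transform: `|⟪v,ξ⟫|ⁿ ‖𝓕f(ξ)‖ ≤ (2π)⁻ⁿ ‖∂ᵥⁿ f‖₁`

Topic `Literature/Analysis/Fourier`. Integration by parts in ONE direction `v`: for a smooth
compactly supported `f : V → E` on a finite-dimensional real inner product space,
`𝓕(∂ᵥ f)(ξ) = 2πi⟪v, ξ⟫ 𝓕f(ξ)` (Mathlib's `Real.fourier_fderiv` evaluated at `v`), hence, iterating,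

  `|⟪v, ξ⟫|ⁿ ‖𝓕 f(ξ)‖ ≤ (2π)⁻ⁿ ∫ ‖∂ᵥⁿ f‖`  (`pow_inner_mul_norm_fourier_le`).

This is the form of "decay from smoothness" needed for ANISOTROPIC supports: a symbol supported in
a box with sides `a₁, …, a_d` along orthonormal directions `v₁, …, v_d` and obeying
`‖∂_{v_i}ⁿ f‖_∞ ≤ M a_i⁻ⁿ` has `|⟪v_i, ξ⟫|ⁿ ‖𝓕f(ξ)‖ ≤ (2π)⁻ⁿ M vol a_i⁻ⁿ` for each `i` separately
(`pow_inner_mul_norm_fourier_le_of_bound`), i.e. `‖𝓕f(ξ)‖ ≲ M vol Πᵢ (1 + aᵢ|ξᵢ|)⁻ᴺ`-type bounds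
direction by direction — e.g. the sector propagators of two-dimensional Fermi liquids
(Benfatto–Giuliani–Mastropietro 2006, Lemma 2.2 (2.52): box `γ^h × γ^h × γ^{h/2}`, decay on the
dual scales). The one-dimensional statement is `ScaledCutoffDecay.pow_mul_norm_fourier_le_of_contDiff`;
the isotropic `‖ξ‖ⁿ`-version is Mathlib's `Real.pow_mul_norm_iteratedFDeriv_fourier_le`.

The directional derivative is the EXISTING operator `Literature.Analysis.Calculus.dirDeriv`
(`dirDeriv v f = (x ↦ Df(x) v)`, file `Analysis/Calculus/AnalyticFlatness.lean`); its smoothness /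
support API for `ℂ`-valued functions lives in `Analysis/Distribution/BoundaryValueLimit.lean` and
`Analysis/Pluripotential/WirtingerDerivatives.lean`; the iterate lemmas below are the versions for a
general complex normed codomain `E` (vector-valued symbols), kept here as light-weight helpers.

PROVED here: iterates of `dirDeriv v` stay smooth and compactly supported, with support in
`tsupport f`; `fourier_dirDeriv` (`𝓕(∂ᵥf)(ξ) = (2πi⟪ξ,v⟫) • 𝓕f(ξ)`), `norm_fourier_dirDeriv`,
`pow_inner_mul_norm_fourier_le`, `pow_inner_mul_norm_fourier_le_of_bound`. [folklore]

## References

* Mathlib `Real.fourier_fderiv`, `Real.fourier_continuousLinearMap_apply`.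
* G. Benfatto, A. Giuliani, V. Mastropietro, Ann. Henri Poincaré 7 (2006) 809–898, Lemma 2.2 and
  its proof ("integrating by parts", p. 11 of arXiv:cond-mat/0507686). [BenfattoGiulianiMastropietro2006]
-/

noncomputable section

open MeasureTheory Real Complex
open scoped FourierTransform RealInnerProductSpace ContDiff
open Literature.Analysis.Calculus (dirDeriv dirDeriv_apply)

namespace Literature.Analysis.Fourier

variable {V : Type*} [NormedAddCommGroup V] [InnerProductSpace ℝ V] [FiniteDimensional ℝ V]
  [MeasurableSpace V] [BorelSpace V]
variable {E : Type*} [NormedAddCommGroup E] [NormedSpace ℂ E]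

omit [FiniteDimensional ℝ V] [MeasurableSpace V] [BorelSpace V] in
/-- Iterates of `∂ᵥ` preserve smoothness (general complex normed codomain). [folklore] -/
theorem contDiff_iterate_dirDeriv {f : V → E} (hf : ContDiff ℝ ∞ f) (v : V) (n : ℕ) :
    ContDiff ℝ ∞ ((dirDeriv v)^[n] f) := by
  induction n generalizing f with
  | zero => simpa using hf
  | succ n ih =>
    rw [Function.iterate_succ_apply]
    exact ih ((contDiff_infty_iff_fderiv.1 hf).2.clm_apply contDiff_const)

omit [FiniteDimensional ℝ V] [MeasurableSpace V] [BorelSpace V] in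
/-- The iterates of `∂ᵥ` are supported in `tsupport f` (general complex normed codomain). [folklore] -/
theorem tsupport_iterate_dirDeriv_subset (f : V → E) (v : V) (n : ℕ) :
    tsupport ((dirDeriv v)^[n] f) ⊆ tsupport f := by
  induction n generalizing f with
  | zero => simp
  | succ n ih =>
    rw [Function.iterate_succ_apply]
    refine (ih (dirDeriv v f)).trans (closure_minimal ?_ (isClosed_tsupport f))
    intro x hx
    rw [Function.mem_support, dirDeriv_apply] at hx
    by_contra hx'
    exact hx (by rw [fderiv_of_notMem_tsupport ℝ hx']; rfl)

omit [FiniteDimensional ℝ V] [MeasurableSpace V] [BorelSpace V] in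
/-- Iterates of `∂ᵥ` preserve compact support (general complex normed codomain). [folklore] -/
theorem hasCompactSupport_iterate_dirDeriv {f : V → E} (hf : HasCompactSupport f) (v : V) (n : ℕ) :
    HasCompactSupport ((dirDeriv v)^[n] f) :=
  hf.of_isClosed_subset (isClosed_tsupport _) (tsupport_iterate_dirDeriv_subset f v n)

/-- **Fourier transform of a directional derivative**: `𝓕(∂ᵥ f)(ξ) = (2πi⟪ξ, v⟫) • 𝓕 f(ξ)` for
smooth compactly supported `f`. [folklore] -/
theorem fourier_dirDeriv {f : V → E} (hf : ContDiff ℝ ∞ f) (hsupp : HasCompactSupport f) (v ξ : V) :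
    𝓕 (dirDeriv v f) ξ = ((2 * π * ⟪ξ, v⟫ : ℝ) * I : ℂ) • 𝓕 f ξ := by
  have hint : Integrable f := hf.continuous.integrable_of_hasCompactSupport hsupp
  have hdiff : Differentiable ℝ f := hf.differentiable (by simp)
  have hfd_cont : Continuous (fderiv ℝ f) := hf.continuous_fderiv (by simp)
  have hfd_int : Integrable (fderiv ℝ f) := hfd_cont.integrable_of_hasCompactSupport (hsupp.fderiv (𝕜 := ℝ))
  have h := congrFun (Real.fourier_fderiv hint hdiff hfd_int) ξ
  have happ : 𝓕 (fderiv ℝ f) ξ v = 𝓕 (fun x => fderiv ℝ f x v) ξ :=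
    Real.fourier_continuousLinearMap_apply (f := fderiv ℝ f) (a := v) (v := ξ) hfd_int
  change 𝓕 (fun x => fderiv ℝ f x v) ξ = _
  have hL : ((-innerSL ℝ : V →L[ℝ] V →L[ℝ] ℝ) ξ) v = -⟪ξ, v⟫ := by simp
  rw [← happ, h, VectorFourier.fourierSMulRight_apply, hL, neg_smul, neg_smul, smul_neg, neg_neg,
    ← Complex.coe_smul, smul_smul]
  congr 1
  push_cast
  ring

/-- Hence `‖𝓕(∂ᵥ f)(ξ)‖ = 2π|⟪v, ξ⟫| ‖𝓕 f(ξ)‖`. [folklore] -/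
theorem norm_fourier_dirDeriv {f : V → E} (hf : ContDiff ℝ ∞ f) (hsupp : HasCompactSupport f) (v ξ : V) :
    ‖𝓕 (dirDeriv v f) ξ‖ = 2 * π * |⟪v, ξ⟫| * ‖𝓕 f ξ‖ := by
  rw [fourier_dirDeriv hf hsupp, norm_smul, norm_mul, Complex.norm_real, Complex.norm_I, mul_one,
    Real.norm_eq_abs, abs_mul, abs_of_pos two_pi_pos, real_inner_comm]

/-- **Directional decay from smoothness**: `|⟪v, ξ⟫|ⁿ ‖𝓕 f(ξ)‖ ≤ (2π)⁻ⁿ ∫ ‖∂ᵥⁿ f‖` for smooth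
compactly supported `f` (integrate by parts `n` times along `v`). [folklore] -/
theorem pow_inner_mul_norm_fourier_le {f : V → E} (hf : ContDiff ℝ ∞ f) (hsupp : HasCompactSupport f)
    (v ξ : V) (n : ℕ) :
    |⟪v, ξ⟫| ^ n * ‖𝓕 f ξ‖ ≤ (2 * π)⁻¹ ^ n * ∫ x, ‖(dirDeriv v)^[n] f x‖ := by
  induction n generalizing f with
  | zero =>
    simp only [pow_zero, one_mul, Function.iterate_zero, id_eq]
    exact VectorFourier.norm_fourierIntegral_le_integral_norm _ _ _ f ξ
  | succ n ih =>
    have h1 := ih (contDiff_iterate_dirDeriv hf v 1) (hasCompactSupport_iterate_dirDeriv hsupp v 1)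
    rw [Function.iterate_one, norm_fourier_dirDeriv hf hsupp, ← Function.iterate_succ_apply] at h1
    have h2π : 0 < 2 * π := two_pi_pos
    -- `|⟪v,ξ⟫|^{n+1} ‖𝓕f‖ = (2π)⁻¹ · (|⟪v,ξ⟫|^n · 2π|⟪v,ξ⟫| ‖𝓕f‖)`
    calc |⟪v, ξ⟫| ^ (n + 1) * ‖𝓕 f ξ‖ = (2 * π)⁻¹ * (|⟪v, ξ⟫| ^ n * (2 * π * |⟪v, ξ⟫| * ‖𝓕 f ξ‖)) := by
          rw [pow_succ]; field_simp
        _ ≤ (2 * π)⁻¹ * ((2 * π)⁻¹ ^ n * ∫ x, ‖(dirDeriv v)^[n + 1] f x‖) :=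
          mul_le_mul_of_nonneg_left h1 (inv_nonneg.2 h2π.le)
        _ = (2 * π)⁻¹ ^ (n + 1) * ∫ x, ‖(dirDeriv v)^[n + 1] f x‖ := by ring

/-- **The anisotropic form**: if `‖∂ᵥⁿ f‖ ≤ M` pointwise and `tsupport f` has measure at most
`vol`, then `|⟪v, ξ⟫|ⁿ ‖𝓕 f(ξ)‖ ≤ (2π)⁻ⁿ M vol`. [folklore] -/
theorem pow_inner_mul_norm_fourier_le_of_bound {f : V → E} (hf : ContDiff ℝ ∞ f) (hsupp : HasCompactSupport f)
    (v ξ : V) (n : ℕ) {M vol : ℝ} (hM : ∀ x, ‖(dirDeriv v)^[n] f x‖ ≤ M)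
    (hvol : (volume (tsupport f)).toReal ≤ vol) :
    |⟪v, ξ⟫| ^ n * ‖𝓕 f ξ‖ ≤ (2 * π)⁻¹ ^ n * (M * vol) := by
  refine (pow_inner_mul_norm_fourier_le hf hsupp v ξ n).trans (mul_le_mul_of_nonneg_left ?_ (by positivity))
  have hM0 : 0 ≤ M := (norm_nonneg _).trans (hM 0)
  set g := (dirDeriv v)^[n] f with hg
  have hzero : ∀ x, x ∉ tsupport f → ‖g x‖ = 0 := fun x hx => by
    rw [norm_eq_zero]
    exact image_eq_zero_of_notMem_tsupport fun h => hx (tsupport_iterate_dirDeriv_subset f v n h)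
  rw [← setIntegral_eq_integral_of_forall_compl_eq_zero hzero]
  have hfin : volume (tsupport f) < ⊤ := hsupp.isCompact.measure_lt_top
  calc ∫ x in tsupport f, ‖g x‖ = ‖∫ x in tsupport f, ‖g x‖‖ := by
        rw [Real.norm_eq_abs, abs_of_nonneg (integral_nonneg fun x => norm_nonneg _)]
    _ ≤ M * (volume (tsupport f)).toReal :=
        norm_setIntegral_le_of_norm_le_const hfin fun x _ => by rw [norm_norm]; exact hM x
    _ ≤ M * vol := mul_le_mul_of_nonneg_left hvol hM0

end Literature.Analysis.Fourier

end
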